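import Summits.ResolutionOfSingularities.ResolutionOfSingularities.Theorems.SectionAscentFibrewiseClosedPointsCertificatesOnRegularBlowupChart
import Summits.ResolutionOfSingularities.ResolutionOfSingularities.Theorems.SectionAscentFibrewiseClosedPointsCertificateRegular
import Summits.ResolutionOfSingularities.ResolutionOfSingularities.Theorems.SectionAscentFibrewiseClosedPointsCertificateRegularBaseChange
import Summits.ResolutionOfSingularities.ResolutionOfSingularities.Theorems.SectionAscentFibrewiseClosedPointsCertificateRegularStrictTransform
import Summits.ResolutionOfSingularities.ResolutionOfSingularities.Theorems.FrobeniusLadderFInjectiveMacaulayficationStalkChartIso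
import Literature.AlgebraicGeometry.Resolution.AffineBlowupAlgebra
import Literature.AlgebraicGeometry.Resolution.ResolutionOfSingularities
import Mathlib.AlgebraicGeometry.AffineScheme
import HarnessLib

/-!
# The blowing up of the generic member of a base-point-free-off-a-closed-point system is regular

Support file for crux stmt-ResolutionOfSingularities-15960
(`SectionAscent.FibrewiseClosedPoints`, line `registered`, calibration stub
`stub_certificatesOnRegularBlowup`).

`A` a domain of finite type over a field `K`, `I = (b₁, …, b_r)`, `X = Bl_I(Spec A)` REGULAR,
`g₁, …, g_s ∈ A` and chart elements `c_{ij} ∈ C_i = (A[It])_{(b_i t)}` with `b_i^m c_{ij} = g_j`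
such that (H) on every chart `D₊(b_i t)` (`b_i ≠ 0`) each prime containing all `c_{ij}` is maximal
and generated by them. Then the blowing up along `I` of the GENERIC MEMBER
`H_g = Spec((K(t) ⊗_K A)/(Σ t_j ⊗ g_j))` is a regular scheme
(`isRegular_affineBlowup_genericSection`): its charts `D₊(φ(b_i)t)` at the generators cover
(`exists_mem_basicOpen_of_le_span`), the stalks are the local rings of the chart rings
(`isRegularLocalRing_stalk_awayι`), and these are regular by
`…CertificatesOnRegularBlowupChart` fed with the chart algebra of
`…CertificateRegularBaseChange` / `…CertificateRegularStrictTransform`. No definitions are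
introduced.

References: The Stacks Project, Tag 0804, Tag 080E; H. Matsumura, *Commutative Ring Theory*,
Thm. 14.2; everything below is folklore.
-/

-- single-problem summit: the doubled namespace component is forced
set_option linter.dupNamespace false
-- Mathlib is built with this depth; the default (1) makes instance search on the chart rings fail
set_option maxSynthPendingDepth 3

noncomputable section

namespace Summit.ResolutionOfSingularities.ResolutionOfSingularities.Theorems.SectionAscent.CertificatesOnRegularBlowup

open AlgebraicGeometry CategoryTheory MvPolynomial Literature.AlgebraicGeometry.Resolution
open Summit.ResolutionOfSingularities.ResolutionOfSingularities.Theorems.SectionAscent.CertificateRegular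
open Summit.ResolutionOfSingularities.ResolutionOfSingularities.Theorems.FInjectiveMacaulayfication.StalkChartIso
open scoped TensorProduct BigOperators Polynomial

/-! ## Charts at generators, stalks, sections on a chart -/

/-- **The charts `D₊(f_i t)` at a family `f` with `J ⊆ (f₁, …, f_r)`, `f_i ∈ J`, cover
`Bl_J(Spec A)`**, and a point only lies in charts of non-zero `f_i` (`D₊(0) = ∅`).
[cite: StacksProject, Tag 0804] -/
theorem exists_mem_basicOpen_of_le_span {A : Type} [CommRing A] {J : Ideal A} {r : ℕ}
    (f : Fin r → A) (hf : ∀ i, f i ∈ J) (hJ : J ≤ Ideal.span (Set.range f))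
    (x : affineBlowup J) :
    ∃ i, f i ≠ 0 ∧ x ∈ Proj.basicOpen (reesGrading J) (reesT (f i) (hf i)) := by
  classical
  have hcover : ⨆ i, Proj.basicOpen (reesGrading J) (reesT (f i) (hf i)) = ⊤ := by
    refine Proj.iSup_basicOpen_eq_top (reesGrading J) _ ((irrelevant_le_span_reesT J).trans ?_)
    rw [Ideal.span_le]
    rintro _ ⟨b', rfl⟩
    obtain ⟨β, hβ⟩ := Ideal.mem_span_range_iff_exists_fun.mp (hJ b'.2)
    have key : reesT (I := J) b'.1 b'.2 =
        ∑ i, algebraMap A (reesAlgebra J) (β i) * reesT (f i) (hf i) := by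
      apply Subtype.ext
      rw [AddSubmonoidClass.coe_finsetSum]
      simp only [coe_reesT, Subalgebra.coe_mul, Subalgebra.coe_algebraMap,
        ← Polynomial.C_eq_algebraMap, Polynomial.C_mul_monomial]
      rw [← map_sum (Polynomial.monomial 1), hβ]
    change reesT (I := J) b'.1 b'.2 ∈ _
    rw [key]
    exact Ideal.sum_mem _ fun i _ => Ideal.mul_mem_left _ _ (Ideal.subset_span ⟨i, rfl⟩)
  have hx : x ∈ (⨆ i, Proj.basicOpen (reesGrading J) (reesT (f i) (hf i))) := by
    rw [hcover]; trivial
  obtain ⟨i, hi⟩ := TopologicalSpace.Opens.mem_iSup.mp hx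
  refine ⟨i, fun h0 => ?_, hi⟩
  rw [reesT_eq_zero (f i) _ h0, Proj.basicOpen_zero] at hi
  exact hi

/-- Chart-to-stalk direction: if the local ring `(A_{(f)})_q` of the chart ring is regular, so is
the stalk of `Proj A` at the image point (stalk maps of open immersions are isomorphisms;
`Spec.stalkIso`). [cite: StacksProject, Tag 0804] -/
theorem isRegularLocalRing_stalk_awayι {R A : Type} [CommRing R] [CommRing A] [Algebra R A]
    (𝒜 : ℕ → Submodule R A) [GradedAlgebra 𝒜] {f : A} {d : ℕ} (f_deg : f ∈ 𝒜 d) (hd : 0 < d)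
    (q : PrimeSpectrum (HomogeneousLocalization.Away 𝒜 f))
    (h : IsRegularLocalRing (Localization.AtPrime q.asIdeal)) :
    IsRegularLocalRing ((Proj 𝒜).presheaf.stalk (Proj.awayι 𝒜 f f_deg hd q)) :=
  haveI := h
  IsRegularLocalRing.of_ringEquiv
    (((asIso ((Proj.awayι 𝒜 f f_deg hd).stalkMap q)).commRingCatIsoToRingEquiv).trans
      (Spec.stalkIso (CommRingCat.of (HomogeneousLocalization.Away 𝒜 f)) q).commRingCatIsoToRingEquiv).symm

/-- **The section `x t^m` on the chart `D₊(at)`**: `(a/1)^m · (x t^m)/(at)^m = x/1`.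
[folklore] -/
theorem reesChartBase_pow_mul_isLocalizationElem {A : Type} [CommRing A] {I : Ideal A} (a : A)
    (ha : a ∈ I) (m : ℕ) (x : A) (hx : x ∈ I ^ m) :
    reesChartBase a ha (a ^ m) * HomogeneousLocalization.Away.isLocalizationElem (reesT_mem a ha)
      (⟨x, rfl⟩ : (⟨Polynomial.monomial m x, reesAlgebra.monomial_mem.mpr hx⟩ : reesAlgebra I) ∈
        reesGrading I m) = reesChartBase a ha x := by
  apply reesChart_injective a ha
  have hF1 : (((⟨Polynomial.monomial m x, reesAlgebra.monomial_mem.mpr hx⟩ : reesAlgebra I) ^ 1 :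
      reesAlgebra I) : Polynomial A) = Polynomial.monomial m x := by
    rw [pow_one]
  rw [map_mul, reesChart_reesChartBase, reesChart_reesChartBase]
  change algebraMap A (Localization.Away a) (a ^ m) *
    reesChart a ha (HomogeneousLocalization.Away.mk (reesGrading I) (reesT_mem a ha) m _ _) = _
  rw [reesChart_mk a ha _ hF1, map_pow, mul_left_comm, ← mul_pow, IsLocalization.Away.mul_invSelf,
    one_pow, mul_one]

/-- The chart element of `x t^m` only depends on `x` (congruence for the dependent pair).
[folklore] -/
theorem isLocalizationElem_congr {A : Type} [CommRing A] {I : Ideal A} (a : A) (ha : a ∈ I)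
    (m : ℕ) {x x' : A} (hx : x ∈ I ^ m) (hx' : x' ∈ I ^ m) (h : x = x') :
    HomogeneousLocalization.Away.isLocalizationElem (reesT_mem a ha)
      (⟨x, rfl⟩ : (⟨Polynomial.monomial m x, reesAlgebra.monomial_mem.mpr hx⟩ : reesAlgebra I) ∈
        reesGrading I m) =
    HomogeneousLocalization.Away.isLocalizationElem (reesT_mem a ha)
      (⟨x', rfl⟩ : (⟨Polynomial.monomial m x', reesAlgebra.monomial_mem.mpr hx'⟩ : reesAlgebra I) ∈
        reesGrading I m) := by
  subst h
  rfl

/-! ## The blowing up of the generic member is regular -/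

section Abstract

variable (K A : Type) [Field K] [CommRing A] [IsDomain A] [Algebra K A] [Algebra.FiniteType K A]
  (I : Ideal A) (hreg : Scheme.IsRegular (affineBlowup I)) (s m : ℕ) (g : Fin s → A)
  (B : Type) [CommRing B] (ι : A →+* B) (τ : MvPolynomial (Fin s) K →+* B)
  (hιτ : ∀ k : K, ι (algebraMap K A k) = τ (MvPolynomial.C k))
  (hτu : ∀ p : MvPolynomial (Fin s) K, p ≠ 0 → IsUnit (τ p))
  (hΦ : Function.Injective (MvPolynomial.eval₂Hom ι (fun j : Fin s => τ (MvPolynomial.X j))))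
  (hgenB : ∀ x : B, ∃ p : MvPolynomial (Fin s) K, p ≠ 0 ∧ ∃ F : MvPolynomial (Fin s) A,
    x * τ p = MvPolynomial.eval₂Hom ι (fun j : Fin s => τ (MvPolynomial.X j)) F)
  (B' : Type) [CommRing B'] (q : B →+* B') (hq : Function.Surjective q)
  (hkq : RingHom.ker q = Ideal.span {∑ j : Fin s, τ (MvPolynomial.X j) * ι (g j)})

include hreg hιτ hτu hΦ hgenB hq hkq in
/-- **Local rings of the strict-transform chart ring are regular** (abstract base change
`ι, τ, q` as in `…CertificateRegularBaseChange` / `…CertificateRegularStrictTransform`): for a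
chart `D₊(at)`, `0 ≠ a ∈ I`, with chart data `c_j` (`a^m c_j = g_j`) satisfying (H), every
localization of `E = (B'[IB't])_{(φ(a)t)}` at a prime is a regular local ring
(`isRegularLocalRing_localization_sectionChart` fed with the chart algebra).
[cite: StacksProject, Tag 080E] -/
theorem isRegularLocalRing_localization_strictTransformChart (a : A) (ha : a ∈ I) (ha0 : a ≠ 0)
    (c : Fin s → HomogeneousLocalization.Away (reesGrading I) (reesT a ha))
    (hc : ∀ j, reesChartBase a ha (a ^ m) * c j = reesChartBase a ha (g j))
    (H : ∀ q : Ideal (HomogeneousLocalization.Away (reesGrading I) (reesT a ha)), q.IsPrime →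
      (∀ j, c j ∈ q) → q.IsMaximal ∧ q = Ideal.span (Set.range c))
    (hmem : q (ι a) ∈ I.map (q.comp ι))
    (𝔮 : PrimeSpectrum (HomogeneousLocalization.Away (reesGrading (I.map (q.comp ι)))
      (reesT (q (ι a)) hmem))) :
    IsRegularLocalRing (Localization.AtPrime 𝔮.asIdeal) := by
  haveI : IsNoetherianRing A := Algebra.FiniteType.isNoetherianRing K A
  obtain ⟨χ, hχC, hχX⟩ := exists_chartPolyMap s ι τ a ha
  obtain ⟨hχinj, hχgen⟩ :=
    stub_certificateRegularBaseChange K A s _ ι τ hιτ hΦ hgenB I a ha χ hχC hχX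
  obtain ⟨θ₀, hθ₀⟩ := exists_sectionChartMap₀ s ι q a ha χ hmem
  obtain ⟨hgenE, hkerE, hθℓ, hθa⟩ := stub_certificateRegularStrictTransform K A s _ ι τ g _ q hq
    hkq I a ha χ hχC hχX hχinj hχgen hmem θ₀ hθ₀
  have hunit : ∀ σ : MvPolynomial (Fin s) K, σ ≠ 0 →
      IsUnit (θ₀ (MvPolynomial.map ((reesChartBase a ha).comp (algebraMap K A)) σ)) := by
    intro σ hσ
    rw [hθ₀, chartPolyMap_jD K A s _ ι τ hιτ a ha χ hχC hχX, blowupAlgebraMap_algebraMap]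
    exact (((hτu σ hσ).map q).map _).map _
  -- the local rings of the chart ring `C₀` of `X` are regular
  have hregC : ∀ p : PrimeSpectrum (HomogeneousLocalization.Away (reesGrading I) (reesT a ha)),
      IsRegularLocalRing (Localization.AtPrime p.asIdeal) := fun p =>
    isRegularLocalRing_of_stalk_awayι (reesGrading I) (reesT_mem a ha) one_pos p (hreg _)
  exact isRegularLocalRing_localization_sectionChart K A I a ha ha0 s m g c hc H _ θ₀ hkerE hθℓ
    hθa hregC hgenE hunit 𝔮

include hreg hιτ hτu hΦ hgenB hq hkq in
/-- **`Bl_I(Spec B')` is regular** for the abstract generic member `B'` and chart data `c_{ij}`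
at generators `b_i` of `I` satisfying (H): the charts `D₊(φ(b_i)t)`, `b_i ≠ 0`, cover, and the
stalks are local rings of the strict-transform chart rings. [cite: StacksProject, Tag 080E] -/
theorem isRegular_affineBlowup_map {r : ℕ} (b : Fin r → A) (hbI : ∀ i, b i ∈ I)
    (hspan : Ideal.span (Set.range b) = I)
    (c : ∀ i, Fin s → HomogeneousLocalization.Away (reesGrading I) (reesT (b i) (hbI i)))
    (hc : ∀ i j, reesChartBase (b i) (hbI i) (b i ^ m) * c i j = reesChartBase (b i) (hbI i) (g j))
    (H : ∀ i, b i ≠ 0 →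
      ∀ q : Ideal (HomogeneousLocalization.Away (reesGrading I) (reesT (b i) (hbI i))), q.IsPrime →
        (∀ j, c i j ∈ q) → q.IsMaximal ∧ q = Ideal.span (Set.range (c i))) :
    Scheme.IsRegular (affineBlowup (I.map (q.comp ι))) := by
  intro x
  -- a chart `D₊(φ(b_i)t) ∋ x` at a non-zero generator
  have hJ : I.map (q.comp ι) ≤ Ideal.span (Set.range fun i => (q.comp ι) (b i)) := by
    rw [← hspan, Ideal.map_span, ← Set.range_comp]
    rfl
  obtain ⟨i, hbi0', hxi⟩ := exists_mem_basicOpen_of_le_span (J := I.map (q.comp ι))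
    (fun i => (q.comp ι) (b i)) (fun i => Ideal.mem_map_of_mem (q.comp ι) (hbI i)) hJ x
  have hbi0 : b i ≠ 0 := fun h => hbi0' (by rw [h, map_zero])
  have hmem : q (ι (b i)) ∈ I.map (q.comp ι) := Ideal.mem_map_of_mem (q.comp ι) (hbI i)
  have hxi' : x ∈ Proj.basicOpen (reesGrading (I.map (q.comp ι))) (reesT (q (ι (b i))) hmem) := hxi
  rw [← Proj.opensRange_awayι (reesGrading (I.map (q.comp ι))) (reesT (q (ι (b i))) hmem)
    (reesT_mem (q (ι (b i))) hmem) one_pos] at hxi'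
  obtain ⟨𝔮, rfl⟩ := Scheme.Hom.mem_opensRange.mp hxi'
  exact isRegularLocalRing_stalk_awayι (reesGrading (I.map (q.comp ι))) (reesT_mem (q (ι (b i))) hmem)
    one_pos 𝔮 (isRegularLocalRing_localization_strictTransformChart K A I hreg s m g B ι τ hιτ hτu
      hΦ hgenB B' q hq hkq (b i) (hbI i) hbi0 (c i) (hc i) (H i hbi0) hmem 𝔮)

end Abstract

/-- **`Bl_I(H_g)` is regular** for `X = Bl_I(Spec A)` regular, `I = (b₁, …, b_r)` and chart data
`c_{ij}`, `b_i^m c_{ij} = g_j`, satisfying (H) (see the module docstring), where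
`H_g = Spec((K(t) ⊗_K A)/(Σ t_j ⊗ g_j))` is the generic member (`isRegular_affineBlowup_map`
for `B = K(t) ⊗_K A`, `tensor_baseChange_hypotheses`). [cite: StacksProject, Tag 080E] -/
theorem isRegular_affineBlowup_genericSection (K A : Type) [Field K] [CommRing A] [IsDomain A]
    [Algebra K A] [Algebra.FiniteType K A] (I : Ideal A)
    (hreg : Scheme.IsRegular (affineBlowup I)) {r : ℕ} (b : Fin r → A) (hbI : ∀ i, b i ∈ I)
    (hspan : Ideal.span (Set.range b) = I) (s m : ℕ) (g : Fin s → A)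
    (c : ∀ i, Fin s → HomogeneousLocalization.Away (reesGrading I) (reesT (b i) (hbI i)))
    (hc : ∀ i j, reesChartBase (b i) (hbI i) (b i ^ m) * c i j = reesChartBase (b i) (hbI i) (g j))
    (H : ∀ i, b i ≠ 0 →
      ∀ q : Ideal (HomogeneousLocalization.Away (reesGrading I) (reesT (b i) (hbI i))), q.IsPrime →
        (∀ j, c i j ∈ q) → q.IsMaximal ∧ q = Ideal.span (Set.range (c i))) :
    let Ks := FractionRing (MvPolynomial (Fin s) K)
    let ℓ : TensorProduct K Ks A :=
      ∑ j : Fin s, (algebraMap (MvPolynomial (Fin s) K) Ks (MvPolynomial.X j)) ⊗ₜ[K] g j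
    let φ : A →+* (TensorProduct K Ks A ⧸ Ideal.span {ℓ}) :=
      (Ideal.Quotient.mk (Ideal.span {ℓ})).comp
        (Algebra.TensorProduct.includeRight (R := K) (A := Ks) (B := A)).toRingHom
    Scheme.IsRegular (affineBlowup (I.map φ)) := by
  intro Ks ℓ φ
  -- the base change `B = K(t) ⊗_K A`
  let ι : A →+* TensorProduct K Ks A :=
    (Algebra.TensorProduct.includeRight (R := K) (A := Ks) (B := A)).toRingHom
  let τ : MvPolynomial (Fin s) K →+* TensorProduct K Ks A :=
    (Algebra.TensorProduct.includeLeftRingHom (R := K) (A := Ks) (B := A)).comp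
      (algebraMap (MvPolynomial (Fin s) K) Ks)
  obtain ⟨hιτ, hτu, hΦ, hgenB⟩ := tensor_baseChange_hypotheses K A s ι τ (fun r => rfl) (fun p => rfl)
  have hℓ : ℓ = ∑ j : Fin s, τ (X j) * ι (g j) := by
    refine Finset.sum_congr rfl fun j _ => ?_
    change _ = (_ ⊗ₜ[K] (1 : A)) * ((1 : Ks) ⊗ₜ[K] g j)
    rw [Algebra.TensorProduct.tmul_mul_tmul, mul_one, one_mul]
  have key := isRegular_affineBlowup_map K A I hreg s m g _ ι τ hιτ hτu hΦ hgenB _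
    (Ideal.Quotient.mk (Ideal.span {ℓ})) Ideal.Quotient.mk_surjective
    (by rw [← hℓ]; exact Ideal.mk_ker) b hbI hspan c hc H
  exact key

/-- **Registered form** (`stub_certificatesOnRegularBlowupCharts`): the blowing up along `I` of the
generic member of a system with chart data satisfying (H) on a regular `Bl_I(Spec A)` is regular —
see `isRegular_affineBlowup_genericSection`. [cite: StacksProject, Tag 080E] -/
theorem stub_certificatesOnRegularBlowupCharts (K A : Type) [Field K] [CommRing A] [IsDomain A] [Algebra K A] [Algebra.FiniteType K A] (I : Ideal A) (hreg : Literature.AlgebraicGeometry.Resolution.Scheme.IsRegular (Literature.AlgebraicGeometry.Resolution.affineBlowup I)) (r : ℕ) (b : Fin r → A) (hbI : ∀ i, b i ∈ I) (hspan : Ideal.span (Set.range b) = I) (s m : ℕ) (g : Fin s → A) (c : ∀ i, Fin s → HomogeneousLocalization.Away (Literature.AlgebraicGeometry.Resolution.reesGrading I) (Literature.AlgebraicGeometry.Resolution.reesT (b i) (hbI i))) (hc : ∀ i j, Literature.AlgebraicGeometry.Resolution.reesChartBase (b i) (hbI i) (b i ^ m) * c i j = Literature.AlgebraicGeometry.Resolution.reesChartBase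 (b i) (hbI i) (g j)) (H : ∀ i, b i ≠ 0 → ∀ q : Ideal (HomogeneousLocalization.Away (Literature.AlgebraicGeometry.Resolution.reesGrading I) (Literature.AlgebraicGeometry.Resolution.reesT (b i) (hbI i))), q.IsPrime → (∀ j, c i j ∈ q) → q.IsMaximal ∧ q = Ideal.span (Set.range (c i))) : let Ks := FractionRing (MvPolynomial (Fin s) K); let ℓ : TensorProduct K Ks A := ∑ j : Fin s, (algebraMap (MvPolynomial (Fin s) K) Ks (MvPolynomial.X j)) ⊗ₜ[K] g j; let φ : A →+* (TensorProduct K Ks A ⧸ Ideal.span {ℓ}) := (Ideal.Quotient.mk (Ideal.span {ℓ})).comp (Algebra.TensorProduct.includeRight (R := K) (A := Ks) (B := A)).toRingHom; Literature.AlgebraicGeometry.Resolution.Scheme.IsRegular (Literature.AlgebraicGeometry.Resolution.affineBlowup (I.map φ)) :=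
  isRegular_affineBlowup_genericSection K A I hreg b hbI hspan s m g c hc H

end Summit.ResolutionOfSingularities.ResolutionOfSingularities.Theorems.SectionAscent.CertificatesOnRegularBlowup

end
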